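import Summits.QuantumFields.YangMills.Theorems.BalabanUVNodesN11TopPairLocalResidualPostR

/-!
EDITION v1.1 (dag-n11-d g31, 2026-08-29; T0′ of the FLAG №1 R2b cure): every `(hloc : (θ.Zh …).LocalLaws)` below now DISPLAYS the one-scale law it uses
(`∀ Y ω ω′, ω k = ω′ k → ζ0 k Y ω = ζ0 k Y ω′` at the child's generation), and the proviso-keyed corollary takes it as `hzh`; the cure re-types the row `zhLocal` IN PLACE to print's
two-scale law ([III] (3.1)–(3.4) pp.264–267).  Content unchanged: «at every θ whose residuals are one-scale», no longer «at every lawful θ».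

# DAG node N11 — THE Ω-TOP FAMILY AT EVERY PARAMETER WITH ONE-SCALE RESIDUALS (`hloc`∕`hzh`, displayed): under a ONE-SCALE locality law the new side of EVERY child with `Ω_{k+1} = 𝕋` is a `V′`-INDEPENDENT constant `c_k(s′)`
# times 11a's fluctuation integral; at the first step the rough-set test then reads, for every pair `(𝕋, Λ₁)`: «𝐓-slot ≡ 0 ∨ `c_0(s′) = 0` (degenerate) ∨ the fluctuation integral
# itself vanishes a.e. on the rough part of the support» (count-neutral, LOCATED)

HEADER — WORK-UNIT METADATA.  Cell `pub-ymgap`, YM-PLAN Track A (HUMAN RULING D-0062), seat `pub-ymgap-dag-n11-d` (g19; N11 [B14], s2), route `BalabanUVNodes`, item K1⁹ =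
stmt-QuantumFields-27364 (helper lane, `--kind proof --supports 27364 --as helper`, count-neutral).  [III] = [Balaban1988Convergent], [IV] = [Balaban1989LargeFieldI], [B7] =
[Balaban1985Averaging].  Over this seat's g19 `…N11TopPairLocalResidual` (★ `WtOfRecord₁₃H_ζ_baseCfg_eq_of_localLaws`) ∕ `…PostR` (`slots_succ_ae_zero_on_of_slotsT`), g18 D1 ∕ D2
`…N11OmegaTopStepWeight.wOfRecord_eq_prod_of_Omega_univ` ∕ `…N11OmegaTopTStep.sect2Slot_eq_of_Omega_univ`, `…N11TopPairRoughSet.chiPrime_univ_avg_eq_zero_of_rough`, g3's fibre lemma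
`transportK_congr_ae_of_fibre`, node00-def-T's RECORD 13 v1.7 `H` (`WtOfRecord₁₃H`, rows `zhLocal`, `TLaw₁₃CoPH`, `tLaw₁₃CoPH_iff`).

WHY THIS FILE.  `…N11TopPairLocalResidual` settles the top pair `(𝕋, 𝕋)`.  g18's Ω-top family (`…N11OmegaTop…`: every child with `Ω_{k+1}(s′) = 𝕋`, any `Λ_{k+1}`) has the new side
`Σ_Y ζ_k(∅)(base_{k+1}V′) · aOp_k[w_k(Λ,Λᶜ,Y)·Π_{j<k}(ζ_j w_j)·exp A_{k+1}(s′;t,(S_Y,A),E′)](base_{k+1}V′)` — and the SAME constancy applies: under the displayed ONE-SCALE law (since W2∕T1′ NOT the row `zhLocal`, which is two-scale), `ζ_k(∅)(base_{k+1}V′) = c_k(s′)` for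
all `V′` (§1), so the new side is `c_k(s′) · I(s′)(V′)` with `I(s′)` = 11a's fluctuation integral summed over `Y`; `c_k(s′) = 0` makes the §2-form slot the zero function and the (O3′)
clause «𝐓-slot `≡ 0` or `= 0` a.e. on the support» (§1, g18 E's `rePinH` reading at EVERY `θ` with one-scale residuals).  At the first step the OLD side of every pair `(𝕋, Λ₁)` — weight
`a(∅)·χ′_0(ALL)·Σ_{R:Λ(R)=Λ₁}Σ_S ζ` (D1) — vanishes for a.e. ROUGH `V′` exactly as at the top pair (§2: on the fibre `Ū = V′`, all (3.2)-small + all (3.3)-small ⇒ `Ū` not rough, [B7] Prop. 2).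
So (O3′) at such a child ⇒ `slotT ≡ 0 ∨ c_0(s′) = 0 ∨ I(s′)(V′) = 0` for a.e. rough `V′` of the support (§3) — the new side's (3.2) cut-off, if the child is not degenerate, must come from
the FLUCTUATION INTEGRAL ITSELF (11a's `aOp_0`: the (3.3)∕(3.16) windows of `χ_A` read at `(1, A, V′)`, `e^{−½quad_0(Λ₁)}`, the new action at `U_1(V′)`), on def-R's unit-branch fields.
The first 𝐓-law hands its own terms to the test (§4).  Post-𝐑 editions by [IV] (0.3) pointwise (§2, §3).

WHAT THIS FILE PROVES (0 `def`, 0 `sorry`, standard axioms).  §1 ★★ `sect2Slot_eq_const_mul_of_Omega_univ_of_localLaws` (every level, every Ω-top child) · `sect2Slot_eq_zero_of_Omega_univ_of_localLaws` ·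
★★ `O3_iff_degenerate_of_Omega_univ_of_const_eq_zero`.  §2 ★★ `slotsT_one_ae_zero_on_rough_of_Omega_univ` (every `θ`, every residual, every pair `(𝕋, Λ₁)`) · `slots_one_ae_zero_on_rough_of_Omega_univ`.
§3 ★★★ `omegaTop_O3_trichotomy_of_localLaws` · ★★★ `omegaTop_S_trichotomy_of_localLaws` (post-𝐑) · `omegaTop_degenerate_of_O3_of_const_eq_zero`.  §4 ★★★★ `tLaw₁₃CoPH_zero_omegaTop_trichotomy`
(every `θ` obeying `hzh`, no proviso read: `TLaw₁₃CoPH θ p 0` ⇒ at every pair `(𝕋, Λ₁)`: 𝐓-slot `≡ 0` ∨ `c_0(s′) = 0` ∨ the law's fluctuation integral vanishes a.e. on the rough support).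

HONEST FRAMING.  A NECESSARY-CONDITION reading on the tree's own rows and objects (count-neutral, LOCATED; repair census in `…N11TopPairLocalResidual`'s header); the third member of §3 is
NOT refuted here (no positivity ∕ integrability of 11a's fluctuation integral is claimed); nothing of Bałaban asserted or refuted; N11 NOT discharged; K1⁹ NOT closed; no registered
stub touched; counts unmoved (typed 28∕28 · discharged 5∕27 · A 5∕28); NOT ℝ⁴ ∕ OS ∕ mass gap ∕ Clay.  No `sorry`, `axiom`, `def`, `instance`, `notation`.  Sources (SHAPE only): [III] Thm 1
p.262, (2.18) p.257, (2.21)–(2.23) p.258, p.267, (3.1)–(3.5) pp.264–265, (3.16) p.268, (3.20)–(3.21) p.269, (3.23)–(3.25) p.270; [IV] (0.3) p.176; [B7] Prop. 2 (53) p.26; [I] =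
[Balaban1987RG1] Thm 1 p.259.
-/

noncomputable section

open MeasureTheory
open scoped BigOperators Matrix.Norms.L2Operator

namespace Summit.QuantumFields.YangMills.Theorems.BalabanUVNodesN11OmegaTopLocalResidual

open Literature.MathematicalPhysics.QuantumFieldTheory.Balaban1983to89 T4Continuum Node00 Node00.Tk B14.Eq218Concrete B14.Sect3Decomp
open Literature.MathematicalPhysics.QuantumFieldTheory.Balaban1983to89.T4AveragingDisintegration (transportK kernelTransport)
open Literature.MathematicalPhysics.QuantumFieldTheory.Balaban1983to89.ExpMeanLog (deltaSU)
open BalabanUVNodesN11AllLargeFieldLabel (sideD_pos sideχ_pos)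
open BalabanUVNodesN11OmegaTopStepWeight (wOfRecord_eq_prod_of_Omega_univ)
open BalabanUVNodesN11OmegaTopTStep (sect2Slot_eq_of_Omega_univ)
open BalabanUVNodesN11TopPairRoughSet (chiPrime_univ_avg_eq_zero_of_rough)
open BalabanUVNodesN11TopPairLocalResidual (WtOfRecord₁₃H_ζ_baseCfg_eq_of_localLaws)
open BalabanUVNodesN11TopPairLocalResidualPostR (slots_succ_ae_zero_on_of_slotsT)

variable {F : T4Family} {N : ℕ} [NeZero N]

/-! ## §1. Every level: the new side of an Ω-top child is a constant times 11a's fluctuation integral -/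

section NewSide

variable (θ : Stage13HParams F N) (p : B12.RunParams)

/-- ★★ **THE NEW SIDE OF A CHILD WITH `Ω_{k+1}(s′) = 𝕋` AT EVERY `θ` OBEYING THE ROW**: `sect2Slot(W^θ(s′), s′, t, E′, U)(V′) = c_k(s′) · Σ_Y aOp_k[…](base_{k+1}V′)` with the
`V′`-INDEPENDENT `c_k(s′) = ζ_k(∅)(base_{k+1} 1)` (g18 D2's closed form; the residual factor read at the base configuration does not read `V′`).
[cite: Balaban1988Convergent, (2.18) p.257, (2.21)–(2.23) p.258, p.267, (3.23)–(3.25) p.270] -/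
theorem sect2Slot_eq_const_mul_of_Omega_univ_of_localLaws {𝔸 : Type*} [NormedRing 𝔸] [NormedAlgebra ℂ 𝔸] [CompleteSpace 𝔸] {k : ℕ}
    (s' : SeqOfRecord F θ.ν θ.τ9.M (gOfRecord₁₃ F N θ.toStage13Params p) p.K (k + 1)) (hloc : ∀ Y ω ω', ω k = ω' k → (θ.Zh p (k + 1) s'.Ω s'.Λ).ζ0 k Y ω = (θ.Zh p (k + 1) s'.Ω s'.Λ).ζ0 k Y ω') (hΩ : s'.Ω (k + 1) = Set.univ)
    (Sg : Sect2.Setting 𝔸 (SU N)) (Rz : Sect2.Residual (F.P p.K) 𝔸) (t : Sect2.TermValues (F.P p.K) 𝔸 (FluctV N) θ.τ9.M) (E' : ℝ) (U : BgMap F N p.K)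
    (V' : GaugeField (F.P p.K) (k + 1) (SU N)) {hdec : DecidableEq (PBond (F.P p.K) k)} :
    sect2Slot F N (FluctV N) p.K Sg Rz (WtOfRecord₁₃H F N θ p s') s' t E' U V' =
      (WtOfRecord₁₃H F N θ p s').ζ k ∅ (baseCfg (V := FluctV N) (k + 1) (fun _ => 1)) *
        ∑ Y ∈ (Set.toFinite {Y : Set (Site (F.P p.K) 0) | Y ∈ SClassOfRecord F θ.ν (gOfRecord₁₃ F N θ.toStage13Params p) p.K (k + 1) ∧ Y ⊆ s'.Ω (k + 1) ∩ (s'.Λ (k + 1))ᶜ}).toFinset,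
          aOp k (genDataOfRecord F N (FluctV N) θ.ν θ.τ9.M (gOfRecord₁₃ F N θ.toStage13Params p) p.K (WtOfRecord₁₃H F N θ p s') s' (Function.update (fun _ => ∅) (k + 1) Y) k).sA
            (genDataOfRecord F N (FluctV N) θ.ν θ.τ9.M (gOfRecord₁₃ F N θ.toStage13Params p) p.K (WtOfRecord₁₃H F N θ p s') s' (Function.update (fun _ => ∅) (k + 1) Y) k).w
            (fun ω => (∏ j ∈ Finset.range k, (WtOfRecord₁₃H F N θ p s').ζ j ∅ ω * (WtOfRecord₁₃H F N θ p s').w j Set.univ ∅ ∅ ω) *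
              sect2Operand F N (FluctV N) p.K Sg Rz s' t E' U (Function.update (fun _ => ∅) (k + 1) Y, fun j => (ω j).2) (fun j => (ω j).1))
            (baseCfg (k + 1) V') := by
  rw [sect2Slot_eq_of_Omega_univ F N θ.ν θ.τ9 p (gOfRecord₁₃ F N θ.toStage13Params p) k Sg Rz (WtOfRecord₁₃H F N θ p s') s' hΩ t E' U V' (hdec := hdec),
    Finset.mul_sum]
  refine Finset.sum_congr rfl fun Y _ => ?_
  congr 1
  rw [hΩ, Set.compl_univ]
  exact WtOfRecord₁₃H_ζ_baseCfg_eq_of_localLaws θ p s' hloc ∅ V' (fun _ => 1)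

/-- **… the zero function as soon as `c_k(s′) = 0`** — whatever the term values, constant and background map. [cite: Balaban1988Convergent, (2.18) p.257, (3.25) p.270 (bookkeeping)] -/
theorem sect2Slot_eq_zero_of_Omega_univ_of_localLaws {𝔸 : Type*} [NormedRing 𝔸] [NormedAlgebra ℂ 𝔸] [CompleteSpace 𝔸] {k : ℕ}
    (s' : SeqOfRecord F θ.ν θ.τ9.M (gOfRecord₁₃ F N θ.toStage13Params p) p.K (k + 1)) (hloc : ∀ Y ω ω', ω k = ω' k → (θ.Zh p (k + 1) s'.Ω s'.Λ).ζ0 k Y ω = (θ.Zh p (k + 1) s'.Ω s'.Λ).ζ0 k Y ω') (hΩ : s'.Ω (k + 1) = Set.univ)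
    (hc : (WtOfRecord₁₃H F N θ p s').ζ k ∅ (baseCfg (V := FluctV N) (k + 1) (fun _ => 1)) = 0)
    (Sg : Sect2.Setting 𝔸 (SU N)) (Rz : Sect2.Residual (F.P p.K) 𝔸) (t : Sect2.TermValues (F.P p.K) 𝔸 (FluctV N) θ.τ9.M) (E' : ℝ) (U : BgMap F N p.K) :
    sect2Slot F N (FluctV N) p.K Sg Rz (WtOfRecord₁₃H F N θ p s') s' t E' U = 0 := by
  classical
  funext V'
  rw [sect2Slot_eq_const_mul_of_Omega_univ_of_localLaws θ p s' hloc hΩ Sg Rz t E' U V' (hdec := fun a b => Classical.propDecidable (a = b)), hc, zero_mul]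
  rfl

/-- ★★ **HENCE, WHEN `c_k(s′) = 0`, THE (O3′) CLAUSE OF THAT CHILD HOLDS IFF ITS 𝐓-SLOT VANISHES (a.e. on the support)** — g18 E's `rePinH` reading at every `θ` obeying the displayed one-scale law, for the
slot family `T` and support `χ` of ANY parameter on the left. [cite: Balaban1988Convergent, Thm 1 p.262, (3.24)–(3.25) p.270, (2.18) p.257] -/
theorem O3_iff_degenerate_of_Omega_univ_of_const_eq_zero {𝔸 : Type*} [NormedRing 𝔸] [NormedAlgebra ℂ 𝔸] [CompleteSpace 𝔸] {k : ℕ}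
    (s' : SeqOfRecord F θ.ν θ.τ9.M (gOfRecord₁₃ F N θ.toStage13Params p) p.K (k + 1)) (hloc : ∀ Y ω ω', ω k = ω' k → (θ.Zh p (k + 1) s'.Ω s'.Λ).ζ0 k Y ω = (θ.Zh p (k + 1) s'.Ω s'.Λ).ζ0 k Y ω') (hΩ : s'.Ω (k + 1) = Set.univ)
    (hc : (WtOfRecord₁₃H F N θ p s').ζ k ∅ (baseCfg (V := FluctV N) (k + 1) (fun _ => 1)) = 0)
    (Sg : Sect2.Setting 𝔸 (SU N)) (Rz : Sect2.Residual (F.P p.K) 𝔸) (t : Sect2.TermValues (F.P p.K) 𝔸 (FluctV N) θ.τ9.M) (E' : ℝ) (U : BgMap F N p.K)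
    (T : Density (F.P p.K) (k + 1) (SU N)) (χ : Density (F.P p.K) (k + 1) (SU N)) :
    (T = 0 ∨ ∀ᵐ V' ∂fieldMeasure (F.P p.K) (k + 1) (SU N), χ V' ≠ 0 → T V' = sect2Slot F N (FluctV N) p.K Sg Rz (WtOfRecord₁₃H F N θ p s') s' t E' U V') ↔
      (T = 0 ∨ ∀ᵐ V' ∂fieldMeasure (F.P p.K) (k + 1) (SU N), χ V' ≠ 0 → T V' = 0) := by
  rw [sect2Slot_eq_zero_of_Omega_univ_of_localLaws θ p s' hloc hΩ hc Sg Rz t E' U]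
  exact Iff.rfl

end NewSide

/-! ## §2. First step: the OLD side of every pair `(𝕋, Λ₁)` vanishes for a.e. rough coarse field (every `θ`, every residual) -/

section OldSide

variable (ν : Stage7Numerics) (τ : TowerNumerics) (E : B12.RunParams → ℝ) (A₁ : ℝ) (ζ : ZetaOfRecord F N ν τ.M) (ppSel : PpSelOfRecord F ν τ.M)
  (p : B12.RunParams) (g : ℕ → ℝ)

/-- ★★ **THE 𝐓-SLOT OF EVERY PAIR `(Ω₁, Λ₁) = (𝕋, Λ₁)` VANISHES FOR a.e. ROUGH COARSE FIELD** (`0 < K`, `0 < sideD`, `0 < sideχ`, [B7] Prop. 2's `α₀` guards, `ε₁η₁² + 8δ₀ ≤ α₀η₁²`):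
the weight is `a(∅)(V′)·χ′_0(ALL)(U,V′)·Σ_{R:Λ(R)=Λ₁}Σ_S ζ` (g18 D1), and on the fibre `Ū = V′` with `V′` rough either some cube is (3.2)-large (`a(∅) = 0`) or `χ′_0(ALL)(U, Ū) = 0` (g18 G §1);
g3's fibre lemma. [cite: Balaban1988Convergent, (3.1)–(3.5) pp.264–265, (3.16) p.268, (3.20)–(3.21) p.269, (3.25) p.270; Balaban1985Averaging, Prop. 2 (53) p.26, (10) p.19] -/
theorem slotsT_one_ae_zero_on_rough_of_Omega_univ (hK : 0 < p.K) (hD : 0 < sideD F ν τ.M p g 0) (hχ : 0 < sideχ F ν p g 0) {α₀ : ℝ} (hα : 0 < α₀)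
    (hα3 : (143 * (((((F.P p.K).d + 4 : ℕ) : ℝ)) ^ 2 / 4) ^ 2) * α₀ ≤ 1 / 3)
    (hα2 : 2 * α₀ ≤ 2 * deltaSU (Fin N) / ((((F.P p.K).d + 4) * (F.P p.K).L : ℕ) : ℝ) ^ 2)
    (hαε : epsOfRecord ν g 1 * (F.P p.K).eta 1 ^ 2 + 4 * (2 * deltaOfRecord ν g 0 A₁) ≤ α₀ * (F.P p.K).eta 1 ^ 2)
    (s' : SeqOfRecord F ν τ.M g p.K 1) (hΩ : s'.Ω 1 = Set.univ) :
    ∀ᵐ V' ∂fieldMeasure (F.P p.K) 1 (SU N), ¬ PlaqSmall (2 * α₀ * (((F.P p.K).L : ℝ) ^ 1 * (F.P p.K).eta 1) ^ 2) V' →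
      slotsTOfRecord F N ν τ E (wOfRecord F N ν τ.M A₁ ζ) ppSel p g 1 s' V' = 0 := by
  classical
  -- the family cut off to the rough coarse fields agrees with the zero family on the graph `V′ = Ū`
  have h := transportK_congr_ae_of_fibre (avOfRecord_measurable F N p.K 0) (avOfRecord_haarAC F N p.K 0 hK)
    (f := fun (V' : GaugeField (F.P p.K) 1 (SU N)) (U : GaugeField (F.P p.K) 0 (SU N)) =>
      (if PlaqSmall (2 * α₀ * (((F.P p.K).L : ℝ) ^ 1 * (F.P p.K).eta 1) ^ 2) V' then (0 : ℝ) else 1) *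
        (wOfRecord F N ν τ.M A₁ ζ p g 0 s' U V' * (chiSeqOfRecord F N ν τ.M g p.K 0 s'.init U * slotsOfRecord F N ν τ E (wOfRecord F N ν τ.M A₁ ζ) ppSel p g 0 s'.init U)))
    (g := fun _ _ => (0 : ℝ)) (fun U => by
      by_cases hs : PlaqSmall (2 * α₀ * (((F.P p.K).L : ℝ) ^ 1 * (F.P p.K).eta 1) ^ 2) ((avOfRecord F N p.K 0).avg U)
      · simp only [hs, if_true, zero_mul]
      · rw [wOfRecord_eq_prod_of_Omega_univ F N ν τ.M A₁ p g 0 ζ hD s' hΩ U ((avOfRecord F N p.K 0).avg U)]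
        by_cases ha : (∏ c : Iχ F ν p g 0, chiFactor F N ν p g 0 c ((avOfRecord F N p.K 0).avg U)) = 0
        · rw [ha, zero_mul, zero_mul, zero_mul, mul_zero]
        · rw [chiPrime_univ_avg_eq_zero_of_rough ν τ.M A₁ p g hχ hα hα3 hα2 hαε s'.init U ha hs, mul_zero, zero_mul, zero_mul, mul_zero])
  filter_upwards [h] with V' hV' hrough
  have h0 : transportK (avOfRecord F N p.K 0).avg (fun _ => (0 : ℝ)) V' = 0 := by
    show kernelTransport _ _ _ (fun _ => (0 : ℝ)) V' = 0
    simp only [kernelTransport, integral_zero, mul_zero]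
  have h1 : transportK (avOfRecord F N p.K 0).avg
      (fun U => (if PlaqSmall (2 * α₀ * (((F.P p.K).L : ℝ) ^ 1 * (F.P p.K).eta 1) ^ 2) V' then (0 : ℝ) else 1) *
        (wOfRecord F N ν τ.M A₁ ζ p g 0 s' U V' * (chiSeqOfRecord F N ν τ.M g p.K 0 s'.init U * slotsOfRecord F N ν τ E (wOfRecord F N ν τ.M A₁ ζ) ppSel p g 0 s'.init U))) V' =
      slotsTOfRecord F N ν τ E (wOfRecord F N ν τ.M A₁ ζ) ppSel p g 1 s' V' := by
    rw [slotsTOfRecord_succ_apply]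
    simp only [hrough, if_false, one_mul]
    rfl
  rw [← h1, hV', h0]

/-- **… and so does the post-𝐑 slot of `ρ₁` there** ([IV] (0.3) pointwise, `…PostR.slots_succ_ae_zero_on_of_slotsT`). [cite: Balaban1989LargeFieldI, (0.3) p.176; Balaban1988Convergent, (3.25) p.270] -/
theorem slots_one_ae_zero_on_rough_of_Omega_univ (hK : 0 < p.K) (hD : 0 < sideD F ν τ.M p g 0) (hχ : 0 < sideχ F ν p g 0) {α₀ : ℝ} (hα : 0 < α₀)
    (hα3 : (143 * (((((F.P p.K).d + 4 : ℕ) : ℝ)) ^ 2 / 4) ^ 2) * α₀ ≤ 1 / 3)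
    (hα2 : 2 * α₀ ≤ 2 * deltaSU (Fin N) / ((((F.P p.K).d + 4) * (F.P p.K).L : ℕ) : ℝ) ^ 2)
    (hαε : epsOfRecord ν g 1 * (F.P p.K).eta 1 ^ 2 + 4 * (2 * deltaOfRecord ν g 0 A₁) ≤ α₀ * (F.P p.K).eta 1 ^ 2)
    (s' : SeqOfRecord F ν τ.M g p.K 1) (hΩ : s'.Ω 1 = Set.univ) :
    ∀ᵐ V' ∂fieldMeasure (F.P p.K) 1 (SU N), ¬ PlaqSmall (2 * α₀ * (((F.P p.K).L : ℝ) ^ 1 * (F.P p.K).eta 1) ^ 2) V' →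
      slotsOfRecord F N ν τ E (wOfRecord F N ν τ.M A₁ ζ) ppSel p g 1 s' V' = 0 :=
  slots_succ_ae_zero_on_of_slotsT ν τ E (wOfRecord F N ν τ.M A₁ ζ) ppSel p g s' _
    (slotsT_one_ae_zero_on_rough_of_Omega_univ ν τ E A₁ ζ ppSel p g hK hD hχ hα hα3 hα2 hαε s' hΩ)

end OldSide

/-! ## §3. First step: the test at every pair `(𝕋, Λ₁)`, at every `θ` obeying the displayed one-scale law -/

section Test

variable (θ : Stage13HParams F N) (p : B12.RunParams)

/-- ★★★ **THE Ω-TOP TRICHOTOMY AT EVERY `θ` OBEYING THE ROW** (first step; `1 ≤ M`, `0 < M₂`, `0 < K`, the `α₀` guards, `ε₁η₁² + 8δ₀ ≤ α₀η₁²`): for a history `s′` of length `1` with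
`Ω₁(s′) = 𝕋` (any `Λ₁`) and any first-step terms `(u₁, e₁)`, (O3′) at `s′` implies `slotT_1(s′) ≡ 0 ∨ c_0(s′) = 0 ∨` for `dV′`-a.e. `V′` with `χ₁(s′)V′ ≠ 0` and `¬PlaqSmall(2α₀(Lη₁)²) V′`
11a's fluctuation integral `Σ_Y aOp_0[w_0(Λ₁,Λ₁ᶜ,Y)·exp A_1(s′; u₁, (S_Y, A), e₁)](base₁V′)` VANISHES. [cite: Balaban1988Convergent, Thm 1 p.262, (3.1)–(3.5) pp.264–265, (3.23)–(3.25) p.270, p.267; Balaban1985Averaging, Prop. 2 (53) p.26] -/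
theorem omegaTop_O3_trichotomy_of_localLaws (hM : 1 ≤ θ.τ9.M) (hM₂ : 0 < θ.ν.M₂) (hK : 0 < p.K) {α₀ : ℝ} (hα : 0 < α₀)
    (hα3 : (143 * (((((F.P p.K).d + 4 : ℕ) : ℝ)) ^ 2 / 4) ^ 2) * α₀ ≤ 1 / 3)
    (hα2 : 2 * α₀ ≤ 2 * deltaSU (Fin N) / ((((F.P p.K).d + 4) * (F.P p.K).L : ℕ) : ℝ) ^ 2)
    (hαε : epsOfRecord θ.ν (gOfRecord₁₃ F N θ.toStage13Params p) 1 * (F.P p.K).eta 1 ^ 2 + 4 * (2 * deltaOfRecord θ.ν (gOfRecord₁₃ F N θ.toStage13Params p) 0 θ.A₁) ≤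
      α₀ * (F.P p.K).eta 1 ^ 2)
    (s' : SeqOfRecord F θ.ν θ.τ9.M (gOfRecord₁₃ F N θ.toStage13Params p) p.K 1) (hloc : ∀ Y ω ω', ω 0 = ω' 0 → (θ.Zh p 1 s'.Ω s'.Λ).ζ0 0 Y ω = (θ.Zh p 1 s'.Ω s'.Λ).ζ0 0 Y ω') (hΩ : s'.Ω 1 = Set.univ)
    (u₁ : Sect2.TermValues (F.P p.K) (MatA N) (FluctV N) θ.τ9.M) (e₁ : ℝ) {hdec : DecidableEq (PBond (F.P p.K) 0)}
    (hO3 : slotsTOfRecord F N θ.ν θ.τ9 (EOfRecord₁₃ F N θ.toStage13Params) (wOfRecord₉ F N θ.toStage9Params) θ.ppSel p (gOfRecord₁₃ F N θ.toStage13Params p) 1 s' = 0 ∨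
      ∀ᵐ V' ∂fieldMeasure (F.P p.K) 1 (SU N),
        chiSeqOfRecord F N θ.ν θ.τ9.M (gOfRecord₁₃ F N θ.toStage13Params p) p.K 1 s' V' ≠ 0 →
          slotsTOfRecord F N θ.ν θ.τ9 (EOfRecord₁₃ F N θ.toStage13Params) (wOfRecord₉ F N θ.toStage9Params) θ.ppSel p (gOfRecord₁₃ F N θ.toStage13Params p) 1 s' V' =
            sect2Slot F N (FluctV N) p.K (settingOfRecord₁₃ F N θ.toStage13Params p) (θ.rzAt p s') (WtOfRecord₁₃H F N θ p s') s' u₁ e₁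
              (UbgOfRecord₁₃CoP F N θ.toStage13Params p 1 s') V') :
    slotsTOfRecord F N θ.ν θ.τ9 (EOfRecord₁₃ F N θ.toStage13Params) (wOfRecord₉ F N θ.toStage9Params) θ.ppSel p (gOfRecord₁₃ F N θ.toStage13Params p) 1 s' = 0 ∨
      (WtOfRecord₁₃H F N θ p s').ζ 0 ∅ (baseCfg (V := FluctV N) 1 (fun _ => 1)) = 0 ∨
      ∀ᵐ V' ∂fieldMeasure (F.P p.K) 1 (SU N),
        chiSeqOfRecord F N θ.ν θ.τ9.M (gOfRecord₁₃ F N θ.toStage13Params p) p.K 1 s' V' ≠ 0 →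
          ¬ PlaqSmall (2 * α₀ * (((F.P p.K).L : ℝ) ^ 1 * (F.P p.K).eta 1) ^ 2) V' →
            (∑ Y ∈ (Set.toFinite {Y : Set (Site (F.P p.K) 0) | Y ∈ SClassOfRecord F θ.ν (gOfRecord₁₃ F N θ.toStage13Params p) p.K 1 ∧ Y ⊆ s'.Ω 1 ∩ (s'.Λ 1)ᶜ}).toFinset,
              aOp 0 (genDataOfRecord F N (FluctV N) θ.ν θ.τ9.M (gOfRecord₁₃ F N θ.toStage13Params p) p.K (WtOfRecord₁₃H F N θ p s') s' (Function.update (fun _ => ∅) 1 Y) 0).sA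
                (genDataOfRecord F N (FluctV N) θ.ν θ.τ9.M (gOfRecord₁₃ F N θ.toStage13Params p) p.K (WtOfRecord₁₃H F N θ p s') s' (Function.update (fun _ => ∅) 1 Y) 0).w
                (fun ω => (∏ j ∈ Finset.range 0, (WtOfRecord₁₃H F N θ p s').ζ j ∅ ω * (WtOfRecord₁₃H F N θ p s').w j Set.univ ∅ ∅ ω) *
                  sect2Operand F N (FluctV N) p.K (settingOfRecord₁₃ F N θ.toStage13Params p) (θ.rzAt p s') s' u₁ e₁ (UbgOfRecord₁₃CoP F N θ.toStage13Params p 1 s')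
                    (Function.update (fun _ => ∅) 1 Y, fun j => (ω j).2) (fun j => (ω j).1))
                (baseCfg 1 V')) = 0 := by
  rcases hO3 with h0 | hid
  · exact Or.inl h0
  · by_cases hc : (WtOfRecord₁₃H F N θ p s').ζ 0 ∅ (baseCfg (V := FluctV N) 1 (fun _ => 1)) = 0
    · exact Or.inr (Or.inl hc)
    · refine Or.inr (Or.inr ?_)
      have hz := slotsT_one_ae_zero_on_rough_of_Omega_univ θ.ν θ.τ9 (EOfRecord₁₃ F N θ.toStage13Params) θ.A₁ θ.ζ θ.ppSel p (gOfRecord₁₃ F N θ.toStage13Params p) hK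
        (sideD_pos θ.ν hM p _ 0) (sideχ_pos hM₂ p _ 0) hα hα3 hα2 hαε s' hΩ
      filter_upwards [hid, hz] with V' hV' hzV' hχ hrough
      have h1 := hV' hχ
      have hlhs : slotsTOfRecord F N θ.ν θ.τ9 (EOfRecord₁₃ F N θ.toStage13Params) (wOfRecord₉ F N θ.toStage9Params) θ.ppSel p
          (gOfRecord₁₃ F N θ.toStage13Params p) 1 s' V' = 0 := hzV' hrough
      rw [hlhs, sect2Slot_eq_const_mul_of_Omega_univ_of_localLaws θ p s' hloc hΩ _ _ u₁ e₁ _ V' (hdec := hdec)] at h1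
      exact (mul_eq_zero.1 h1.symm).resolve_left hc

/-- ★★★ **THE POST-𝐑 EDITION** (the §2-form clause of `ρ₁`'s slot at the child, [IV] (0.3) pointwise): the same trichotomy for `slot_1(s′)`.
[cite: Balaban1988Convergent, Thm 1 p.262, (2.18) p.257, (3.1)–(3.5) pp.264–265, (3.23)–(3.25) p.270; Balaban1989LargeFieldI, (0.3) p.176; Balaban1985Averaging, Prop. 2 (53) p.26] -/
theorem omegaTop_S_trichotomy_of_localLaws (hM : 1 ≤ θ.τ9.M) (hM₂ : 0 < θ.ν.M₂) (hK : 0 < p.K) {α₀ : ℝ} (hα : 0 < α₀)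
    (hα3 : (143 * (((((F.P p.K).d + 4 : ℕ) : ℝ)) ^ 2 / 4) ^ 2) * α₀ ≤ 1 / 3)
    (hα2 : 2 * α₀ ≤ 2 * deltaSU (Fin N) / ((((F.P p.K).d + 4) * (F.P p.K).L : ℕ) : ℝ) ^ 2)
    (hαε : epsOfRecord θ.ν (gOfRecord₁₃ F N θ.toStage13Params p) 1 * (F.P p.K).eta 1 ^ 2 + 4 * (2 * deltaOfRecord θ.ν (gOfRecord₁₃ F N θ.toStage13Params p) 0 θ.A₁) ≤
      α₀ * (F.P p.K).eta 1 ^ 2)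
    (s' : SeqOfRecord F θ.ν θ.τ9.M (gOfRecord₁₃ F N θ.toStage13Params p) p.K 1) (hloc : ∀ Y ω ω', ω 0 = ω' 0 → (θ.Zh p 1 s'.Ω s'.Λ).ζ0 0 Y ω = (θ.Zh p 1 s'.Ω s'.Λ).ζ0 0 Y ω') (hΩ : s'.Ω 1 = Set.univ)
    (u₁ : Sect2.TermValues (F.P p.K) (MatA N) (FluctV N) θ.τ9.M) (e₁ : ℝ) {hdec : DecidableEq (PBond (F.P p.K) 0)}
    (hS : slotsOfRecord F N θ.ν θ.τ9 (EOfRecord₁₃ F N θ.toStage13Params) (wOfRecord₉ F N θ.toStage9Params) θ.ppSel p (gOfRecord₁₃ F N θ.toStage13Params p) 1 s' = 0 ∨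
      ∀ᵐ V' ∂fieldMeasure (F.P p.K) 1 (SU N),
        chiSeqOfRecord F N θ.ν θ.τ9.M (gOfRecord₁₃ F N θ.toStage13Params p) p.K 1 s' V' ≠ 0 →
          slotsOfRecord F N θ.ν θ.τ9 (EOfRecord₁₃ F N θ.toStage13Params) (wOfRecord₉ F N θ.toStage9Params) θ.ppSel p (gOfRecord₁₃ F N θ.toStage13Params p) 1 s' V' =
            sect2Slot F N (FluctV N) p.K (settingOfRecord₁₃ F N θ.toStage13Params p) (θ.rzAt p s') (WtOfRecord₁₃H F N θ p s') s' u₁ e₁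
              (UbgOfRecord₁₃CoP F N θ.toStage13Params p 1 s') V') :
    slotsOfRecord F N θ.ν θ.τ9 (EOfRecord₁₃ F N θ.toStage13Params) (wOfRecord₉ F N θ.toStage9Params) θ.ppSel p (gOfRecord₁₃ F N θ.toStage13Params p) 1 s' = 0 ∨
      (WtOfRecord₁₃H F N θ p s').ζ 0 ∅ (baseCfg (V := FluctV N) 1 (fun _ => 1)) = 0 ∨
      ∀ᵐ V' ∂fieldMeasure (F.P p.K) 1 (SU N),
        chiSeqOfRecord F N θ.ν θ.τ9.M (gOfRecord₁₃ F N θ.toStage13Params p) p.K 1 s' V' ≠ 0 →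
          ¬ PlaqSmall (2 * α₀ * (((F.P p.K).L : ℝ) ^ 1 * (F.P p.K).eta 1) ^ 2) V' →
            (∑ Y ∈ (Set.toFinite {Y : Set (Site (F.P p.K) 0) | Y ∈ SClassOfRecord F θ.ν (gOfRecord₁₃ F N θ.toStage13Params p) p.K 1 ∧ Y ⊆ s'.Ω 1 ∩ (s'.Λ 1)ᶜ}).toFinset,
              aOp 0 (genDataOfRecord F N (FluctV N) θ.ν θ.τ9.M (gOfRecord₁₃ F N θ.toStage13Params p) p.K (WtOfRecord₁₃H F N θ p s') s' (Function.update (fun _ => ∅) 1 Y) 0).sA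
                (genDataOfRecord F N (FluctV N) θ.ν θ.τ9.M (gOfRecord₁₃ F N θ.toStage13Params p) p.K (WtOfRecord₁₃H F N θ p s') s' (Function.update (fun _ => ∅) 1 Y) 0).w
                (fun ω => (∏ j ∈ Finset.range 0, (WtOfRecord₁₃H F N θ p s').ζ j ∅ ω * (WtOfRecord₁₃H F N θ p s').w j Set.univ ∅ ∅ ω) *
                  sect2Operand F N (FluctV N) p.K (settingOfRecord₁₃ F N θ.toStage13Params p) (θ.rzAt p s') s' u₁ e₁ (UbgOfRecord₁₃CoP F N θ.toStage13Params p 1 s')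
                    (Function.update (fun _ => ∅) 1 Y, fun j => (ω j).2) (fun j => (ω j).1))
                (baseCfg 1 V')) = 0 := by
  rcases hS with h0 | hid
  · exact Or.inl h0
  · by_cases hc : (WtOfRecord₁₃H F N θ p s').ζ 0 ∅ (baseCfg (V := FluctV N) 1 (fun _ => 1)) = 0
    · exact Or.inr (Or.inl hc)
    · refine Or.inr (Or.inr ?_)
      have hz := slots_one_ae_zero_on_rough_of_Omega_univ θ.ν θ.τ9 (EOfRecord₁₃ F N θ.toStage13Params) θ.A₁ θ.ζ θ.ppSel p (gOfRecord₁₃ F N θ.toStage13Params p) hK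
        (sideD_pos θ.ν hM p _ 0) (sideχ_pos hM₂ p _ 0) hα hα3 hα2 hαε s' hΩ
      filter_upwards [hid, hz] with V' hV' hzV' hχ hrough
      have h1 := hV' hχ
      have hlhs : slotsOfRecord F N θ.ν θ.τ9 (EOfRecord₁₃ F N θ.toStage13Params) (wOfRecord₉ F N θ.toStage9Params) θ.ppSel p
          (gOfRecord₁₃ F N θ.toStage13Params p) 1 s' V' = 0 := hzV' hrough
      rw [hlhs, sect2Slot_eq_const_mul_of_Omega_univ_of_localLaws θ p s' hloc hΩ _ _ u₁ e₁ _ V' (hdec := hdec)] at h1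
      exact (mul_eq_zero.1 h1.symm).resolve_left hc

/-- ★★★ **A CHILD WITH `c_k(s′) = 0` IS DEGENERATE** (every level): its (O3′) clause gives a 𝐓-slot that is the zero function or vanishes a.e. on its support.
[cite: Balaban1988Convergent, Thm 1 p.262, (2.18) p.257, (3.24)–(3.25) p.270] -/
theorem omegaTop_degenerate_of_O3_of_const_eq_zero {𝔸 : Type*} [NormedRing 𝔸] [NormedAlgebra ℂ 𝔸] [CompleteSpace 𝔸] {k : ℕ}
    (s' : SeqOfRecord F θ.ν θ.τ9.M (gOfRecord₁₃ F N θ.toStage13Params p) p.K (k + 1)) (hloc : ∀ Y ω ω', ω k = ω' k → (θ.Zh p (k + 1) s'.Ω s'.Λ).ζ0 k Y ω = (θ.Zh p (k + 1) s'.Ω s'.Λ).ζ0 k Y ω') (hΩ : s'.Ω (k + 1) = Set.univ)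
    (hc : (WtOfRecord₁₃H F N θ p s').ζ k ∅ (baseCfg (V := FluctV N) (k + 1) (fun _ => 1)) = 0)
    (Sg : Sect2.Setting 𝔸 (SU N)) (Rz : Sect2.Residual (F.P p.K) 𝔸) (t : Sect2.TermValues (F.P p.K) 𝔸 (FluctV N) θ.τ9.M) (E' : ℝ) (U : BgMap F N p.K)
    (T : Density (F.P p.K) (k + 1) (SU N)) (χ : Density (F.P p.K) (k + 1) (SU N))
    (hO3 : T = 0 ∨ ∀ᵐ V' ∂fieldMeasure (F.P p.K) (k + 1) (SU N), χ V' ≠ 0 → T V' = sect2Slot F N (FluctV N) p.K Sg Rz (WtOfRecord₁₃H F N θ p s') s' t E' U V') :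
    T = 0 ∨ ∀ᵐ V' ∂fieldMeasure (F.P p.K) (k + 1) (SU N), χ V' ≠ 0 → T V' = 0 :=
  (O3_iff_degenerate_of_Omega_univ_of_const_eq_zero θ p s' hloc hΩ hc Sg Rz t E' U T χ).1 hO3

end Test

/-! ## §4. The first 𝐓-law hands its own terms to the test -/

section TLaw

variable (θ : Stage13HParams F N) (p : B12.RunParams)

/-- (v1.1, T0′ of the FLAG №1 R2b cure: the DISPLAYED one-scale law `hzh` of the step-1 residuals replaces the proviso structure, whose row `zhLocal` the cure re-types to print's two-scale law.) ★★★★ **`TLaw₁₃CoPH θ p 0` AT A PAIR `(𝕋, Λ₁)`, EVERY `θ` WHOSE STEP-1 RESIDUALS OBEY `hzh` (no proviso read; name kept) AND THE GUARDS**: the pair's 𝐓-slot is the zero function, OR `c_0(s′) = 0` (then it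
vanishes a.e. on its support, §3), OR — for the law's own witness terms `(t s′, E s′)` — 11a's fluctuation integral vanishes for a.e. rough `V′` of the support.
[cite: Balaban1988Convergent, Thm 1 p.262, remark p.262, Def. p.279, (3.1)–(3.5) pp.264–265, (3.23)–(3.25) p.270, p.267; Balaban1985Averaging, Prop. 2 (53) p.26] -/
theorem tLaw₁₃CoPH_zero_omegaTop_trichotomy (hzh : ∀ (Ω Λ : ℕ → Set (Site (F.P p.K) 0)) Y ω ω', ω 0 = ω' 0 → (θ.Zh p 1 Ω Λ).ζ0 0 Y ω = (θ.Zh p 1 Ω Λ).ζ0 0 Y ω') (hM : 1 ≤ θ.τ9.M) (hM₂ : 0 < θ.ν.M₂) (hK : 0 < p.K) {α₀ : ℝ} (hα : 0 < α₀)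
    (hα3 : (143 * (((((F.P p.K).d + 4 : ℕ) : ℝ)) ^ 2 / 4) ^ 2) * α₀ ≤ 1 / 3)
    (hα2 : 2 * α₀ ≤ 2 * deltaSU (Fin N) / ((((F.P p.K).d + 4) * (F.P p.K).L : ℕ) : ℝ) ^ 2)
    (hαε : epsOfRecord θ.ν (gOfRecord₁₃ F N θ.toStage13Params p) 1 * (F.P p.K).eta 1 ^ 2 + 4 * (2 * deltaOfRecord θ.ν (gOfRecord₁₃ F N θ.toStage13Params p) 0 θ.A₁) ≤
      α₀ * (F.P p.K).eta 1 ^ 2)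
    (hT : TLaw₁₃CoPH F N θ p 0)
    (s' : SeqOfRecord F θ.ν θ.τ9.M (gOfRecord₁₃ F N θ.toStage13Params p) p.K 1) (hΩ : s'.Ω 1 = Set.univ) {hdec : DecidableEq (PBond (F.P p.K) 0)} :
    slotsTOfRecord F N θ.ν θ.τ9 (EOfRecord₁₃ F N θ.toStage13Params) (wOfRecord₉ F N θ.toStage9Params) θ.ppSel p (gOfRecord₁₃ F N θ.toStage13Params p) 1 s' = 0 ∨
      (WtOfRecord₁₃H F N θ p s').ζ 0 ∅ (baseCfg (V := FluctV N) 1 (fun _ => 1)) = 0 ∨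
      ∃ (u₁ : Sect2.TermValues (F.P p.K) (MatA N) (FluctV N) θ.τ9.M) (e₁ : ℝ),
        ∀ᵐ V' ∂fieldMeasure (F.P p.K) 1 (SU N),
          chiSeqOfRecord F N θ.ν θ.τ9.M (gOfRecord₁₃ F N θ.toStage13Params p) p.K 1 s' V' ≠ 0 →
            ¬ PlaqSmall (2 * α₀ * (((F.P p.K).L : ℝ) ^ 1 * (F.P p.K).eta 1) ^ 2) V' →
              (∑ Y ∈ (Set.toFinite {Y : Set (Site (F.P p.K) 0) | Y ∈ SClassOfRecord F θ.ν (gOfRecord₁₃ F N θ.toStage13Params p) p.K 1 ∧ Y ⊆ s'.Ω 1 ∩ (s'.Λ 1)ᶜ}).toFinset,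
                aOp 0 (genDataOfRecord F N (FluctV N) θ.ν θ.τ9.M (gOfRecord₁₃ F N θ.toStage13Params p) p.K (WtOfRecord₁₃H F N θ p s') s' (Function.update (fun _ => ∅) 1 Y) 0).sA
                  (genDataOfRecord F N (FluctV N) θ.ν θ.τ9.M (gOfRecord₁₃ F N θ.toStage13Params p) p.K (WtOfRecord₁₃H F N θ p s') s' (Function.update (fun _ => ∅) 1 Y) 0).w
                  (fun ω => (∏ j ∈ Finset.range 0, (WtOfRecord₁₃H F N θ p s').ζ j ∅ ω * (WtOfRecord₁₃H F N θ p s').w j Set.univ ∅ ∅ ω) *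
                    sect2Operand F N (FluctV N) p.K (settingOfRecord₁₃ F N θ.toStage13Params p) (θ.rzAt p s') s' u₁ e₁ (UbgOfRecord₁₃CoP F N θ.toStage13Params p 1 s')
                      (Function.update (fun _ => ∅) 1 Y, fun j => (ω j).2) (fun j => (ω j).1))
                  (baseCfg 1 V')) = 0 := by
  obtain ⟨t, Ek, -, hall⟩ := (tLaw₁₃CoPH_iff F N θ p 0).1 hT
  rcases omegaTop_O3_trichotomy_of_localLaws θ p hM hM₂ hK hα hα3 hα2 hαε s' (hzh s'.Ω s'.Λ) hΩ (t s') (Ek s') (hdec := hdec) (hall s').2 with h0 | hc | hI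
  · exact Or.inl h0
  · exact Or.inr (Or.inl hc)
  · exact Or.inr (Or.inr ⟨t s', Ek s', hI⟩)

end TLaw

end Summit.QuantumFields.YangMills.Theorems.BalabanUVNodesN11OmegaTopLocalResidual

end
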